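import Summits.CriticalPhenomena.CardyFormulaZ2.Theorems.CardyMeckeFlipMeckeRigidityPivotalMass

/-!
# The unit square in a model: crossing probability `1/2` and positive pivotal mass

Route `Summits/CriticalPhenomena/CardyFormulaZ2/Theses/CardyMeckeFlip`, crux `MeckeRigidity`
(item stmt-CriticalPhenomena-14826), line `registered` (lead c4), support lemma.

The abstract results `measureReal_crossedEvent_eq_half` (file `…CrossingHalf`: under (E2)+(D) a quad admitting a
TRANSPOSING ISOMETRY is crossed with probability `1/2`) and `exists_pivotalMass_of_transposing_isometry` (file
`…PivotalMass`: in a model such a quad carries pivotal mass at some cutoff) are made concrete for Schramm–Smirnov's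
unit square `Quad.unitSquare` (`z = (s,t) ↦ s + it`): the quarter turn `w ↦ i·w + 1` about its centre `(1+i)/2` is an
isometry of `ℂ` carrying the carrier `[0,1]²` to itself and side `k` onto side `k+1` (`exists_isometryEquiv_quarterTurn`,
`unitSquare_isometry_quarterTurn`, `exists_transposing_isometry_unitSquare`; explicit carrier/sides `unitSquare_carrier`, `unitSquare_side_*`).  Hence in EVERY
model of the six clauses of the crux the unit square is crossed with probability exactly `1/2`
(`measureReal_crossedEvent_unitSquare_eq_half`) and its pivotal set has positive `M ε S`-mass with positive
probability at some cutoff `ε > 0` (`exists_pivotalMass_unitSquare`, registered `∀`-form).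
-/

noncomputable section

open MeasureTheory Set Filter Complex
open scoped unitInterval
open Literature.Probability.Percolation Literature.Probability.Percolation.QuadCrossing

namespace Summit.CriticalPhenomena.CardyFormulaZ2.Theorems.CardyMeckeFlip

/-! ### The unit square: explicit carrier and sides -/

/-- `unitSquare (s,t) = s + it`. [folklore] -/
theorem unitSquare_apply (z : I × I) :
    Quad.unitSquare z = ((z.1 : ℝ) : ℂ) + ((z.2 : ℝ) : ℂ) * Complex.I := rfl

/-- Real part of a point of the unit square. [folklore] -/
@[simp] theorem unitSquare_apply_re (z : I × I) : (Quad.unitSquare z).re = (z.1 : ℝ) := by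
  simp [unitSquare_apply]

/-- Imaginary part of a point of the unit square. [folklore] -/
@[simp] theorem unitSquare_apply_im (z : I × I) : (Quad.unitSquare z).im = (z.2 : ℝ) := by
  simp [unitSquare_apply]

/-- The carrier of the unit square is `[0,1]²`. [folklore] -/
theorem unitSquare_carrier :
    Quad.unitSquare.carrier = {w : ℂ | w.re ∈ Icc (0 : ℝ) 1 ∧ w.im ∈ Icc (0 : ℝ) 1} := by
  ext w
  simp only [Quad.carrier, mem_range, mem_setOf_eq, mem_Icc]
  constructor
  · rintro ⟨z, rfl⟩
    rw [unitSquare_apply_re, unitSquare_apply_im]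
    exact ⟨⟨z.1.2.1, z.1.2.2⟩, z.2.2.1, z.2.2.2⟩
  · rintro ⟨⟨h1, h2⟩, h3, h4⟩
    refine ⟨(⟨w.re, ⟨h1, h2⟩⟩, ⟨w.im, ⟨h3, h4⟩⟩), ?_⟩
    apply Complex.ext
    · rw [unitSquare_apply_re]
    · rw [unitSquare_apply_im]

/-- Side `0` (left) of the unit square. [folklore] -/
theorem unitSquare_side_zero :
    Quad.unitSquare.side 0 = {w : ℂ | w.re = 0 ∧ w.im ∈ Icc (0 : ℝ) 1} := by
  ext w
  simp only [Quad.side, mem_image, mem_setOf_eq, mem_Icc]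
  constructor
  · rintro ⟨z, hz, rfl⟩
    rw [unitSquare_apply_re, unitSquare_apply_im, hz]
    exact ⟨rfl, z.2.2.1, z.2.2.2⟩
  · rintro ⟨h1, h3, h4⟩
    refine ⟨(0, ⟨w.im, ⟨h3, h4⟩⟩), rfl, ?_⟩
    apply Complex.ext
    · rw [unitSquare_apply_re, h1]; rfl
    · rw [unitSquare_apply_im]

/-- Side `1` (bottom) of the unit square. [folklore] -/
theorem unitSquare_side_one :
    Quad.unitSquare.side 1 = {w : ℂ | w.im = 0 ∧ w.re ∈ Icc (0 : ℝ) 1} := by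
  ext w
  simp only [Quad.side, mem_image, mem_setOf_eq, mem_Icc]
  constructor
  · rintro ⟨z, hz, rfl⟩
    rw [unitSquare_apply_re, unitSquare_apply_im, hz]
    exact ⟨rfl, z.1.2.1, z.1.2.2⟩
  · rintro ⟨h1, h3, h4⟩
    refine ⟨(⟨w.re, ⟨h3, h4⟩⟩, 0), rfl, ?_⟩
    apply Complex.ext
    · rw [unitSquare_apply_re]
    · rw [unitSquare_apply_im, h1]; rfl

/-- Side `2` (right) of the unit square. [folklore] -/
theorem unitSquare_side_two :
    Quad.unitSquare.side 2 = {w : ℂ | w.re = 1 ∧ w.im ∈ Icc (0 : ℝ) 1} := by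
  ext w
  simp only [Quad.side, mem_image, mem_setOf_eq, mem_Icc]
  constructor
  · rintro ⟨z, hz, rfl⟩
    rw [unitSquare_apply_re, unitSquare_apply_im, hz]
    exact ⟨rfl, z.2.2.1, z.2.2.2⟩
  · rintro ⟨h1, h3, h4⟩
    refine ⟨(1, ⟨w.im, ⟨h3, h4⟩⟩), rfl, ?_⟩
    apply Complex.ext
    · rw [unitSquare_apply_re, h1]; rfl
    · rw [unitSquare_apply_im]

/-- Side `3` (top) of the unit square. [folklore] -/
theorem unitSquare_side_three :
    Quad.unitSquare.side 3 = {w : ℂ | w.im = 1 ∧ w.re ∈ Icc (0 : ℝ) 1} := by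
  ext w
  simp only [Quad.side, mem_image, mem_setOf_eq, mem_Icc]
  constructor
  · rintro ⟨z, hz, rfl⟩
    rw [unitSquare_apply_re, unitSquare_apply_im, hz]
    exact ⟨rfl, z.1.2.1, z.1.2.2⟩
  · rintro ⟨h1, h3, h4⟩
    refine ⟨(⟨w.re, ⟨h3, h4⟩⟩, 1), rfl, ?_⟩
    apply Complex.ext
    · rw [unitSquare_apply_re]
    · rw [unitSquare_apply_im, h1]; rfl

/-! ### The quarter turn about the centre of the unit square -/

/-- **The quarter turn** `w ↦ i·w + 1` of the plane (rotation by `π/2` about `(1+i)/2`, the centre of the unit square)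
is a self-isometry of `ℂ` (existence form: no new definition is introduced in this proof file). [folklore] -/
theorem exists_isometryEquiv_quarterTurn : ∃ g : ℂ ≃ᵢ ℂ, ∀ w, g w = Complex.I * w + 1 :=
  ⟨{ toFun := fun w => Complex.I * w + 1
     invFun := fun z => -Complex.I * (z - 1)
     left_inv := fun w => by
       show -Complex.I * (Complex.I * w + 1 - 1) = w
       rw [add_sub_cancel_right, ← mul_assoc, neg_mul, Complex.I_mul_I, neg_neg, one_mul]
     right_inv := fun z => by
       show Complex.I * (-Complex.I * (z - 1)) + 1 = z
       rw [← mul_assoc, mul_neg, Complex.I_mul_I, neg_neg, one_mul, sub_add_cancel]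
     isometry_toFun := Isometry.of_dist_eq fun w w' => by
       show dist (Complex.I * w + 1) (Complex.I * w' + 1) = dist w w'
       rw [dist_add_right, Complex.dist_eq, Complex.dist_eq, ← mul_sub, norm_mul, Complex.norm_I, one_mul] },
    fun _ => rfl⟩

/-- Images under the quarter turn by a forward/backward membership check (`z = i·(-i(z-1)) + 1`). [folklore] -/
theorem image_quarterTurn_eq {g : ℂ ≃ᵢ ℂ} (hg : ∀ w, g w = Complex.I * w + 1) {A B : Set ℂ}
    (h₁ : ∀ w ∈ A, Complex.I * w + 1 ∈ B) (h₂ : ∀ z ∈ B, -Complex.I * (z - 1) ∈ A) : g '' A = B := by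
  ext z
  simp only [mem_image]
  constructor
  · rintro ⟨w, hw, rfl⟩
    rw [hg]
    exact h₁ w hw
  · intro hz
    refine ⟨-Complex.I * (z - 1), h₂ z hz, ?_⟩
    rw [hg, ← mul_assoc, mul_neg, Complex.I_mul_I, neg_neg, one_mul, sub_add_cancel]

/-- Real part of `i·w + 1`. [folklore] -/
theorem re_I_mul_add_one (w : ℂ) : (Complex.I * w + 1).re = -w.im + 1 := by simp

/-- Imaginary part of `i·w + 1`. [folklore] -/
theorem im_I_mul_add_one (w : ℂ) : (Complex.I * w + 1).im = w.re := by simp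

/-- Real part of `-i·(z - 1)`. [folklore] -/
theorem re_neg_I_mul_sub_one (z : ℂ) : (-Complex.I * (z - 1)).re = z.im := by simp

/-- Imaginary part of `-i·(z - 1)`. [folklore] -/
theorem im_neg_I_mul_sub_one (z : ℂ) : (-Complex.I * (z - 1)).im = 1 - z.re := by simp

/-- **The quarter turn transposes the unit square**: it carries the carrier `[0,1]²` to itself and side `k` onto side
`k + 1`. [folklore] -/
theorem unitSquare_isometry_quarterTurn {g : ℂ ≃ᵢ ℂ} (hg : ∀ w, g w = Complex.I * w + 1) :
    (Quad.unitSquare.isometry g).carrier = Quad.unitSquare.carrier ∧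
      (Quad.unitSquare.isometry g).side 0 = Quad.unitSquare.side 1 ∧
      (Quad.unitSquare.isometry g).side 1 = Quad.unitSquare.side 2 ∧
      (Quad.unitSquare.isometry g).side 2 = Quad.unitSquare.side 3 ∧
      (Quad.unitSquare.isometry g).side 3 = Quad.unitSquare.side 0 := by
  have hco : ⇑g.toHomeomorph = ⇑g := rfl
  refine ⟨?_, ?_, ?_, ?_, ?_⟩
  · rw [quad_isometry_eq_mapHomeomorph, Quad.carrier_mapHomeomorph, hco, unitSquare_carrier]
    refine image_quarterTurn_eq hg (fun w hw => ?_) (fun z hz => ?_)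
    · simp only [mem_setOf_eq, mem_Icc, re_I_mul_add_one, im_I_mul_add_one] at hw ⊢
      obtain ⟨⟨h1, h2⟩, h3, h4⟩ := hw
      exact ⟨⟨by linarith, by linarith⟩, h1, h2⟩
    · simp only [mem_setOf_eq, mem_Icc, re_neg_I_mul_sub_one, im_neg_I_mul_sub_one] at hz ⊢
      obtain ⟨⟨h1, h2⟩, h3, h4⟩ := hz
      exact ⟨⟨h3, h4⟩, by linarith, by linarith⟩
  · rw [quad_isometry_eq_mapHomeomorph, Quad.side_mapHomeomorph, hco, unitSquare_side_zero,
      unitSquare_side_one]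
    refine image_quarterTurn_eq hg (fun w hw => ?_) (fun z hz => ?_)
    · simp only [mem_setOf_eq, mem_Icc, re_I_mul_add_one, im_I_mul_add_one] at hw ⊢
      obtain ⟨h1, h3, h4⟩ := hw
      exact ⟨h1, by linarith, by linarith⟩
    · simp only [mem_setOf_eq, mem_Icc, re_neg_I_mul_sub_one, im_neg_I_mul_sub_one] at hz ⊢
      obtain ⟨h1, h3, h4⟩ := hz
      exact ⟨h1, by linarith, by linarith⟩
  · rw [quad_isometry_eq_mapHomeomorph, Quad.side_mapHomeomorph, hco, unitSquare_side_one,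
      unitSquare_side_two]
    refine image_quarterTurn_eq hg (fun w hw => ?_) (fun z hz => ?_)
    · simp only [mem_setOf_eq, mem_Icc, re_I_mul_add_one, im_I_mul_add_one] at hw ⊢
      obtain ⟨h1, h3, h4⟩ := hw
      exact ⟨by linarith, h3, h4⟩
    · simp only [mem_setOf_eq, mem_Icc, re_neg_I_mul_sub_one, im_neg_I_mul_sub_one] at hz ⊢
      obtain ⟨h1, h3, h4⟩ := hz
      exact ⟨by linarith, h3, h4⟩
  · rw [quad_isometry_eq_mapHomeomorph, Quad.side_mapHomeomorph, hco, unitSquare_side_two,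
      unitSquare_side_three]
    refine image_quarterTurn_eq hg (fun w hw => ?_) (fun z hz => ?_)
    · simp only [mem_setOf_eq, mem_Icc, re_I_mul_add_one, im_I_mul_add_one] at hw ⊢
      obtain ⟨h1, h3, h4⟩ := hw
      exact ⟨h1, by linarith, by linarith⟩
    · simp only [mem_setOf_eq, mem_Icc, re_neg_I_mul_sub_one, im_neg_I_mul_sub_one] at hz ⊢
      obtain ⟨h1, h3, h4⟩ := hz
      exact ⟨h1, by linarith, by linarith⟩
  · rw [quad_isometry_eq_mapHomeomorph, Quad.side_mapHomeomorph, hco, unitSquare_side_three,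
      unitSquare_side_zero]
    refine image_quarterTurn_eq hg (fun w hw => ?_) (fun z hz => ?_)
    · simp only [mem_setOf_eq, mem_Icc, re_I_mul_add_one, im_I_mul_add_one] at hw ⊢
      obtain ⟨h1, h3, h4⟩ := hw
      exact ⟨by linarith, h3, h4⟩
    · simp only [mem_setOf_eq, mem_Icc, re_neg_I_mul_sub_one, im_neg_I_mul_sub_one] at hz ⊢
      obtain ⟨h1, h3, h4⟩ := hz
      exact ⟨by linarith, h3, h4⟩

/-- **The unit square admits a transposing isometry** (carrier to itself, side `k` to side `k+1`). [folklore] -/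
theorem exists_transposing_isometry_unitSquare : ∃ g : ℂ ≃ᵢ ℂ,
    (Quad.unitSquare.isometry g).carrier = Quad.unitSquare.carrier ∧
      (Quad.unitSquare.isometry g).side 0 = Quad.unitSquare.side 1 ∧
      (Quad.unitSquare.isometry g).side 1 = Quad.unitSquare.side 2 ∧
      (Quad.unitSquare.isometry g).side 2 = Quad.unitSquare.side 3 ∧
      (Quad.unitSquare.isometry g).side 3 = Quad.unitSquare.side 0 := by
  obtain ⟨g, hg⟩ := exists_isometryEquiv_quarterTurn
  exact ⟨g, unitSquare_isometry_quarterTurn hg⟩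

/-! ### Consequences for models of the crux -/

/-- **In every (E2)+(D) law the unit square is crossed with probability `1/2`** (the concrete instance of
`measureReal_crossedEvent_eq_half` supplied by the quarter turn). [cite: SchrammSmirnov2011, §1.3 (the square, duality)] -/
theorem measureReal_crossedEvent_unitSquare_eq_half (P : Measure (QuadConfig (univ : Set ℂ)))
    [IsProbabilityMeasure P]
    (hE2 : ∀ g : ℂ ≃ᵢ ℂ, Measure.map (QuadConfig.isometry g) P = P)
    (hD : ∀ (n : ℕ) (Q Qt : Fin n → Quad (univ : Set ℂ)),
      (∀ i, (Qt i).carrier = (Q i).carrier ∧ (Qt i).side 0 = (Q i).side 1 ∧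
        (Qt i).side 1 = (Q i).side 2 ∧ (Qt i).side 2 = (Q i).side 3 ∧ (Qt i).side 3 = (Q i).side 0) →
      ∀ A : Set (Set (Fin n)), P {S | {i | Q i ∈ S} ∈ A} = P {S | {i | Qt i ∉ S} ∈ A}) :
    P.real (QuadConfig.crossedEvent Quad.unitSquare) = 1 / 2 := by
  obtain ⟨g, hg⟩ := exists_transposing_isometry_unitSquare
  exact measureReal_crossedEvent_eq_half P hE2 hD Quad.unitSquare g hg

/-- **In every model the unit square carries pivotal mass** (registered sub-goal `exists_pivotalMass_unitSquare` of
item stmt-CriticalPhenomena-14826): under (E2)+(D)+(ADM)+(F)+(EXT) there is a cutoff `ε > 0` at which the pivotal set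
of the unit square has positive `M ε S`-mass with positive `P`-probability (the quarter turn instance of
`exists_pivotalMass_of_transposing_isometry`). [folklore] -/
theorem exists_pivotalMass_unitSquare : ∀ (P : Measure (QuadConfig (Set.univ : Set ℂ))) (M : ℝ → QuadConfig (Set.univ : Set ℂ) → Measure ℂ), IsProbabilityMeasure P → (∀ g : ℂ ≃ᵢ ℂ, Measure.map (QuadConfig.isometry g) P = P) → (∀ (n : ℕ) (Q Qt : Fin n → Quad (Set.univ : Set ℂ)), (∀ i, (Qt i).carrier = (Q i).carrier ∧ (Qt i).side 0 = (Q i).side 1 ∧ (Qt i).side 1 = (Q i).side 2 ∧ (Qt i).side 2 = (Q i).side 3 ∧ (Qt i).side 3 = (Q i).side 0) → ∀ A : Set (Set (Fin n)), P {S | {i | Q i ∈ S} ∈ A} = P {S | {i | Qt i ∉ S} ∈ A}) → IsAdmissibleKernel P M → (∀ ε : ℝ, 0 < ε → IsFlipFairKernel P (M ε)) → IsFlipExtremal P M → ∃ ε : ℝ, 0 < ε ∧ ¬ (∀ᵐ S ∂P, M ε S {x | S.IsPivotalAt x Quad.unitSquare} = 0) := by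
  intro P M hP hE2 hD hADM hF hEXT
  obtain ⟨g, hc, h0, h1, h2, h3⟩ := exists_transposing_isometry_unitSquare
  exact exists_pivotalMass_of_transposing_isometry P M hP hE2 hD hADM hF hEXT Quad.unitSquare g hc h0 h1 h2 h3

end Summit.CriticalPhenomena.CardyFormulaZ2.Theorems.CardyMeckeFlip

end
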